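import Mathlib.RingTheory.MvPolynomial.Homogeneous
import Mathlib.Algebra.MvPolynomial.Monad
import Mathlib.Algebra.MvPolynomial.Division
import Mathlib.RingTheory.Polynomial.UniqueFactorization
import Mathlib.FieldTheory.Finite.Basic
import Summits.Langlands.Langlands.Theorems.TriangulineChamberTypeSeeds
import HarnessLib

/-!
# `TypeSeeds` kernels, II: the binary forms vanishing on the rational cone are `θ · Sym`

Companion to `Summits/Langlands/Langlands/Theorems/TriangulineChamberTypeSeeds.lean` (informal
support item `TypeSeeds` = stmt-Langlands-8609 of route `TriangulineChamber`; no route decl exists,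
these are `--supports` kernels).  There, `θ = X^q Y − X Y^q ∈ 𝔽_q[X, Y]` was shown to transform by
`det` under `GL₂(𝔽_q)`, to be the product of the `q + 1` rational linear forms, and to kill every
rational point, so that `θ · Sym^{M−q−1} ⊆ {f ∈ Sym^M | f ≡ 0 on 𝔽_q²}`.  This file proves the
reverse inclusion:

* `theta_dvd_of_isHomogeneous_of_forall_eval_eq_zero`: a binary form over a finite field `K`
  (`|K| = q`) that vanishes at every point of `K²` is divisible by `θ`;
* `theta_dvd_iff_forall_eval_eq_zero`: hence, for a homogeneous `f`, `θ ∣ f ↔ f ≡ 0 on K²`.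

Consequently `Sym^M / θ · Sym^{M−q−1}` (`M ≥ 1`) injects `GL₂(K)`-equivariantly into the functions
on the rational cone `K² ∖ 0` that are homogeneous of degree `M` under `Kˣ` — the induced
representation `Ind_B^{GL₂(K)}` of a character, a principal series of dimension `q + 1` — and is all
of it for `M ≥ q` by a dimension count (`(M+1) − (M−q) = q+1`).  This is the elementary
representation theory behind the rank-growth step (iv) of the seeding argument recorded on the
item (each step of the θ-tower `Sym^a ↪ Sym^{a+q+1} ↪ ⋯` adds the Jordan–Hölder constituents of one
principal series, so the multiplicity of every modular Serre weight grows linearly along the tower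
while the ordinary rank stays bounded).  [folklore; L. E. Dickson, *A fundamental system of
invariants of the general modular linear group with a solution of the form problem*,
Trans. AMS 12 (1911), for the invariant theory of `GL₂(𝔽_q)` on `𝔽_q[X, Y]`]

Proof: `θ = Y · ∏_{a ∈ K} (X − aY)` (`X_mul_prod_linear_forms_eq_theta`); the `q + 1` factors are
pairwise relatively prime in the factorial ring `K[X, Y]`, and each divides `f`: `Y ∣ f` because the
`X^M`-coefficient of `f` is `f(1, 0) = 0`, and `(X − aY) ∣ f` because, after the unipotent change of
variables `X ↦ X + aY`, the `Y^M`-coefficient of `f(X + aY, Y)` is `f(a, 1) = 0`.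
Nothing here is a definition; no Literature fact is used.
-/

set_option linter.dupNamespace false -- project-wide option (lakefile weak.linter.dupNamespace); `Summit.Langlands.Langlands` is the mandated namespace

namespace Summit.Langlands.Langlands.Theorems.TypeSeeds

open MvPolynomial

/-! ### Divisibility by a variable and by a rational linear form -/

/-- Divisibility by a variable, coefficientwise [folklore]: `X_i ∣ f` iff every monomial in the
support of `f` involves `X_i` (Mathlib's `X_dvd_iff_modMonomial_eq_zero`, unfolded). -/
theorem X_dvd_iff_forall_coeff_eq_zero {R : Type*} [CommSemiring R] {σ : Type*} (i : σ)
    (f : MvPolynomial σ R) : X i ∣ f ↔ ∀ d : σ →₀ ℕ, d i = 0 → coeff d f = 0 := by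
  rw [X_dvd_iff_modMonomial_eq_zero, MvPolynomial.ext_iff]
  have key : ∀ d : σ →₀ ℕ, Finsupp.single i 1 ≤ d ↔ d i ≠ 0 := fun d => by
    rw [Finsupp.single_le_iff, Nat.one_le_iff_ne_zero]
  constructor
  · intro h d hd
    have := h d
    rwa [coeff_modMonomial_of_not_le _ (by rw [key]; exact not_not.mpr hd), coeff_zero] at this
  · intro h d
    rw [coeff_zero]
    by_cases hle : Finsupp.single i 1 ≤ d
    · exact coeff_modMonomial_of_le _ hle
    · rw [coeff_modMonomial_of_not_le _ hle]
      exact h d (not_not.mp ((key d).not.mp hle))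

/-- A form of degree `M` evaluated at the coordinate point `e_j` returns its `X_j^M`-coefficient
[folklore]. -/
theorem eval_pi_single_one_of_isHomogeneous {R : Type*} [CommSemiring R] {σ : Type*} [Fintype σ]
    [DecidableEq σ] {f : MvPolynomial σ R} {M : ℕ} (hf : f.IsHomogeneous M) (j : σ) :
    eval (Pi.single j 1) f = coeff (Finsupp.single j M) f := by
  rw [eval_eq']
  rw [Finset.sum_eq_single (Finsupp.single j M)]
  · rw [Finset.prod_eq_one (fun i _ => ?_), mul_one]
    by_cases hij : i = j
    · subst hij; simp
    · simp [hij]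
  · intro d hd hne
    by_cases h : ∃ i, i ≠ j ∧ d i ≠ 0
    · obtain ⟨i, hij, hi⟩ := h
      rw [Finset.prod_eq_zero (Finset.mem_univ i) (by rw [Pi.single_eq_of_ne hij, zero_pow hi]),
        mul_zero]
    · push Not at h
      exfalso
      apply hne
      rw [Finsupp.eq_single_iff]
      refine ⟨fun i hi => ?_, ?_⟩
      · rw [Finset.mem_singleton]
        by_contra hij
        exact (Finsupp.mem_support_iff.mp hi) (h i hij)
      · have hdeg : d.degree = M := by
          by_contra hdeg
          exact (mem_support_iff.mp hd) (hf.coeff_eq_zero hdeg)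
        rw [← hdeg, Finsupp.degree_eq_sum, Finset.sum_eq_single j (fun i _ hij => h i hij)
          (fun hj => absurd (Finset.mem_univ j) hj)]
  · intro h
    rw [notMem_support_iff.mp h, zero_mul]

/-- For a binary form `f` of degree `M` and `{i, j} = {0, 1}`: if `f(e_j) = 0` then `X_i ∣ f`
[folklore] (the only monomial of degree `M` without `X_i` is `X_j^M`, whose coefficient is
`f(e_j)`). -/
theorem X_dvd_of_isHomogeneous_of_eval_eq_zero {R : Type*} [CommSemiring R]
    {f : MvPolynomial (Fin 2) R} {M : ℕ} (hf : f.IsHomogeneous M) {i j : Fin 2} (hij : i ≠ j)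
    (h : eval (Pi.single j 1) f = 0) : X i ∣ f := by
  rw [eval_pi_single_one_of_isHomogeneous hf] at h
  rw [X_dvd_iff_forall_coeff_eq_zero]
  intro d hdi
  by_contra hne
  have hdeg : d.degree = M := by
    by_contra hdeg
    exact hne (hf.coeff_eq_zero hdeg)
  have hd : d = Finsupp.single j M := by
    rw [Finsupp.eq_single_iff]
    refine ⟨fun k hk => ?_, ?_⟩
    · rw [Finset.mem_singleton]
      have hk' : d k ≠ 0 := Finsupp.mem_support_iff.mp hk
      have hki : k ≠ i := fun e => hk' (e ▸ hdi)
      fin_cases i <;> fin_cases j <;> fin_cases k <;> simp_all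
    · rw [← hdeg, Finsupp.degree_eq_sum, Fin.sum_univ_two]
      fin_cases i <;> fin_cases j <;> simp_all
  rw [hd] at hne
  exact hne h

/-- The unipotent change of variables `X ↦ X + aY, Y ↦ Y` followed by `X ↦ X − aY, Y ↦ Y` is the
identity [folklore]. -/
theorem bind₁_shear_neg_shear {R : Type*} [CommRing R] (a : R) (f : MvPolynomial (Fin 2) R) :
    bind₁ (![X 0 - C a * X 1, X 1] : Fin 2 → MvPolynomial (Fin 2) R)
      (bind₁ (![X 0 + C a * X 1, X 1] : Fin 2 → MvPolynomial (Fin 2) R) f) = f := by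
  rw [bind₁_bind₁]
  have : (fun i => bind₁ (![X 0 - C a * X 1, X 1] : Fin 2 → MvPolynomial (Fin 2) R)
      ((![X 0 + C a * X 1, X 1] : Fin 2 → MvPolynomial (Fin 2) R) i)) = X := by
    funext i
    fin_cases i
    · simp only [Fin.zero_eta, Matrix.cons_val_zero, map_add, map_mul, bind₁_X_right,
        bind₁_C_right, Matrix.cons_val_one]
      ring
    · simp
  rw [this, bind₁_X_left, AlgHom.id_apply]

/-- `(X − aY) ∣ f` as soon as `X ∣ f(X + aY, Y)` [folklore] (apply the inverse substitution). -/
theorem linearForm_dvd_of_X_dvd_shear {R : Type*} [CommRing R] (a : R)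
    {f : MvPolynomial (Fin 2) R}
    (h : (X 0 : MvPolynomial (Fin 2) R) ∣
      bind₁ (![X 0 + C a * X 1, X 1] : Fin 2 → MvPolynomial (Fin 2) R) f) :
    (X 0 - C a * X 1 : MvPolynomial (Fin 2) R) ∣ f := by
  have := map_dvd (bind₁ (![X 0 - C a * X 1, X 1] : Fin 2 → MvPolynomial (Fin 2) R)) h
  rwa [bind₁_X_right, Matrix.cons_val_zero, bind₁_shear_neg_shear] at this

/-- Evaluation commutes with substitution [folklore]: `(f ∘ σ)(v) = f(σ(v))`. -/
theorem eval_bind₁ {R : Type*} [CommRing R] {σ τ : Type*} (v : τ → R)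
    (g : σ → MvPolynomial τ R) (f : MvPolynomial σ R) :
    eval v (bind₁ g f) = eval (fun i => eval v (g i)) f :=
  eval₂Hom_bind₁ (RingHom.id R) v g f

/-- **A rational linear form divides every binary form vanishing on its line** [folklore]: if the
binary form `f` of degree `M` satisfies `f(a, 1) = 0` then `(X − aY) ∣ f`. -/
theorem linearForm_dvd_of_isHomogeneous_of_eval_eq_zero {R : Type*} [CommRing R] (a : R)
    {f : MvPolynomial (Fin 2) R} {M : ℕ} (hf : f.IsHomogeneous M) (h : eval ![a, 1] f = 0) :
    (X 0 - C a * X 1 : MvPolynomial (Fin 2) R) ∣ f := by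
  apply linearForm_dvd_of_X_dvd_shear
  have hg : (bind₁ (![X 0 + C a * X 1, X 1] : Fin 2 → MvPolynomial (Fin 2) R) f).IsHomogeneous
      M := by
    have := hf.aeval (![X 0 + C a * X 1, X 1] : Fin 2 → MvPolynomial (Fin 2) R) (n := 1) ?_
    · rw [one_mul] at this
      exact this
    · intro i
      fin_cases i
      · exact (isHomogeneous_X R 0).add (isHomogeneous_C_mul_X a 1)
      · exact isHomogeneous_X R 1
  refine X_dvd_of_isHomogeneous_of_eval_eq_zero hg (i := 0) (j := 1) (by decide) ?_
  rw [eval_bind₁]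
  have hv : (fun i => eval (Pi.single (1 : Fin 2) (1 : R))
      ((![X 0 + C a * X 1, X 1] : Fin 2 → MvPolynomial (Fin 2) R) i)) = ![a, 1] := by
    funext i
    fin_cases i <;> simp
  rw [hv, h]

/-- `Y` does not divide `X − aY` [folklore]. -/
theorem not_X_one_dvd_linearForm {R : Type*} [CommRing R] [Nontrivial R] (a : R) :
    ¬ (X 1 : MvPolynomial (Fin 2) R) ∣ X 0 - C a * X 1 := by
  rw [X_dvd_iff_forall_coeff_eq_zero]
  intro h
  have := h (Finsupp.single 0 1) (by simp)
  rw [coeff_sub, coeff_C_mul, coeff_X, coeff_X, if_pos rfl, if_neg] at this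
  · simp at this
  · rw [Finsupp.single_eq_single_iff]; simp

/-- `Y` and `X − aY` are relatively prime in `K[X, Y]` [folklore] (`Y` is prime and does not divide
`X − aY`). -/
theorem isRelPrime_X_one_linearForm {K : Type*} [Field K] (a : K) :
    IsRelPrime (X 1 : MvPolynomial (Fin 2) K) (X 0 - C a * X 1) := by
  rw [(X_prime (R := K) (i := (1 : Fin 2))).irreducible.isRelPrime_iff_not_dvd]
  exact not_X_one_dvd_linearForm a

/-- Distinct rational linear forms `X − aY`, `X − bY` (`a ≠ b`) are relatively prime in `K[X, Y]`
[folklore]: a common divisor divides `(a − b)Y`, hence `Y` (prime), hence is a unit. -/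
theorem isRelPrime_linearForms {K : Type*} [Field K] {a b : K} (hab : a ≠ b) :
    IsRelPrime (X 0 - C a * X 1 : MvPolynomial (Fin 2) K) (X 0 - C b * X 1) := by
  intro d ha hb
  have hd : d ∣ C (a - b) * X 1 := by
    have := dvd_sub hb ha
    convert this using 1
    simp only [map_sub]
    ring
  have hu : IsUnit (C (a - b) : MvPolynomial (Fin 2) K) :=
    (isUnit_iff_ne_zero.mpr (sub_ne_zero.mpr hab)).map C
  rw [hu.dvd_mul_left] at hd
  rcases (X_prime (R := K) (i := (1 : Fin 2))).irreducible.dvd_iff.mp hd with h | h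
  · exact h
  · exact absurd (h.dvd.trans ha) (not_X_one_dvd_linearForm a)

/-! ### The forms vanishing on the rational cone -/

/-- **Binary forms vanishing on the rational cone are divisible by `θ`** [folklore; Dickson]:
over a finite field `K` with `q` elements, a homogeneous `f ∈ K[X, Y]` with `f(v) = 0` for every
`v ∈ K²` is a multiple of `θ = X^q Y − X Y^q`.  With `theta_mul_injective` and
`eval_theta_mul_eq_zero` (companion file): `θ · Sym^{M−q−1} = {f ∈ Sym^M | f ≡ 0 on K²}`, so
`Sym^M / θ·Sym^{M−q−1}` is a space of functions on the rational cone (a principal series of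
`GL₂(K)` once `M ≥ q`). -/
theorem theta_dvd_of_isHomogeneous_of_forall_eval_eq_zero (K : Type*) [Field K] [Fintype K]
    {f : MvPolynomial (Fin 2) K} {M : ℕ} (hf : f.IsHomogeneous M)
    (h : ∀ v : Fin 2 → K, eval v f = 0) :
    (X 0 ^ Fintype.card K * X 1 - X 0 * X 1 ^ Fintype.card K : MvPolynomial (Fin 2) K) ∣ f := by
  classical
  rw [← X_mul_prod_linear_forms_eq_theta K]
  refine IsRelPrime.mul_dvd (IsRelPrime.prod_right fun a _ => isRelPrime_X_one_linearForm a) ?_ ?_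
  · refine X_dvd_of_isHomogeneous_of_eval_eq_zero hf (i := 1) (j := 0) (by decide) (h _)
  · refine Fintype.prod_dvd_of_isRelPrime (fun a b hab => isRelPrime_linearForms hab) fun a => ?_
    exact linearForm_dvd_of_isHomogeneous_of_eval_eq_zero a hf (h _)

/-- Hence, for a homogeneous binary form `f` over a finite field `K` (`|K| = q`):
`θ ∣ f ↔ f ≡ 0 on K²` [folklore] — the image of the (injective, `GL₂(K)`-equivariant)
θ-multiplication `Sym^{M−q−1} ⊗ det → Sym^M` is exactly the kernel of the evaluation map to the
functions on the rational cone. -/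
theorem theta_dvd_iff_forall_eval_eq_zero (K : Type*) [Field K] [Fintype K]
    {f : MvPolynomial (Fin 2) K} {M : ℕ} (hf : f.IsHomogeneous M) :
    (X 0 ^ Fintype.card K * X 1 - X 0 * X 1 ^ Fintype.card K : MvPolynomial (Fin 2) K) ∣ f ↔
      ∀ v : Fin 2 → K, eval v f = 0 := by
  refine ⟨fun ⟨g, hg⟩ v => ?_, theta_dvd_of_isHomogeneous_of_forall_eval_eq_zero K hf⟩
  rw [hg]
  exact eval_theta_mul_eq_zero K v g

end Summit.Langlands.Langlands.Theorems.TypeSeeds
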